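import Literature.AlgebraicGeometry.Frobenioids.DirectSumPerfFactorial
import Literature.AlgebraicGeometry.Frobenioids.PerfFactorialSupport
import Literature.AlgebraicGeometry.Frobenioids.RlfStructure
import HarnessLib

/-!
# Frobenioids I, Def. 2.4 (i): supports in the realification of a direct sum `⊕_i M_i` of monoprime monoids

Mochizuki, *The geometry of Frobenioids I*, Kyushu J. Math. **62** (2008), Def. 2.4 (i) p. 47–48 (`Supp(a)`, the
realification `M^rlf = {a ∈ M^rlf_factor | Supp(a) ⊆ Supp(b) for some b ∈ M^pf}`), Ex. 6.3 p. 113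
("`Prime(Φ(L)) ≃ V(L)`") [cite: MochizukiFrdI2008, Def. 2.4(i) p.48] [cite: MochizukiFrdI2008, Ex. 6.3 p.113].

PROOF-ONLY.  For `M = ⊕_i M_i` with MONOPRIME `M_i` (perf-factorial, `DirectSum.isPerfFactorial`; primes `≃ ι`,
`DirectSum.primesEquiv`):
* `DirectSum.mem_supp_factorMap_of_iff` — the support of (the factorization of) `ι(f)`, `f ∈ ⊕_i M_i`, read
  through `Prime(M) ≅ Prime(M^pf)` (`Primes.perfectionEquiv`), is the set of primes of the indices in the
  support of `f`: `𝔮(𝔭) ∈ Supp(f) ⟺ idx 𝔭 ∈ supp f` (via `IsPerfFactorial.mem_supp_factorMap_of_iff`: a primary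
  `a₀ ∈ 𝔭` with `a₀ ≼ f` exists iff `f_{idx 𝔭} ≠ 0`);
* `DirectSum.supp_factorMap_of_finite`, `DirectSum.supp_factorMap_finite` — supports of factorizations of
  elements of `M^pf` are FINITE;
* `DirectSum.supp_coe_rlf_finite` — hence EVERY element of `(⊕_i M_i)^rlf` has finite support: the realified
  divisor monoids `Φ(L)^rlf` of the §6 examples are "finitely supported `ℝ_{≥0}`-valued divisors" (the first
  step towards `(Φ^rlf)^gp(L) = ⊕_v ℝ`, Thm. 6.4 (i) p. 115).
Seat abc-iut-L1-d2 (cell abc-iut).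
-/

noncomputable section

namespace Literature.AlgebraicGeometry.Frobenioids

open Function Literature.AnabelianGeometry.EtaleTheta

universe u v

namespace DirectSum

variable {ι : Type u} {M : ι → Type v} [∀ i, CommMonoid (M i)] [DecidableEq ι]
  (hM : ∀ i, IsMonoprime (M i))
include hM

/-- **The support of `ι(f)` is the set of primes of the indices where `f ≠ 0`**: for `𝔭 ∈ Prime(⊕_i M_i)`, the
corresponding prime of `(⊕_i M_i)^pf` lies in `Supp(f)` iff `f_{idx 𝔭} ≠ 0`. [cite: MochizukiFrdI2008, Def. 2.4(i) p.47] -/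
theorem mem_supp_factorMap_of_iff (f : directSum M) (𝔭 : Primes (directSum M)) :
    Primes.perfectionEquiv (isPerfFactorial hM).isDivisorial.isSharp 𝔭 ∈
        supp (factorMap (directSum M) (Perfection.of (directSum M) f)) ↔
      idx hM 𝔭 ∈ dsupp (f : ∀ j, M j) := by
  rw [(isPerfFactorial hM).mem_supp_factorMap_of_iff]
  constructor
  · rintro ⟨a₀, ha₀, hle⟩
    have hcar : a₀ ∈ (primeOf hM (idx hM 𝔭)).carrier := by rw [primeOf_idx]; exact ha₀
    have hsupp : dsupp (a₀ : ∀ j, M j) = {idx hM 𝔭} := (mem_carrier_primeOf_iff hM _ a₀).mp hcar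
    have hsub := (precsim_iff_dsupp_subset hM a₀ f).mp hle
    rw [hsupp, Set.singleton_subset_iff] at hsub
    exact hsub
  · intro hi
    refine ⟨single (idx hM 𝔭) ((f : ∀ j, M j) (idx hM 𝔭)), ?_, ?_⟩
    · have hcar : single (idx hM 𝔭) ((f : ∀ j, M j) (idx hM 𝔭)) ∈ (primeOf hM (idx hM 𝔭)).carrier :=
        (mem_carrier_primeOf_iff hM _ _).mpr (dsupp_single hi)
      rw [primeOf_idx] at hcar
      exact hcar
    · rw [precsim_iff_dsupp_subset hM, dsupp_single hi, Set.singleton_subset_iff]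
      exact hi

/-- The support of `ι(f)` is contained in the (finite) set of primes of the indices in the support of `f`.
[cite: MochizukiFrdI2008, Def. 2.4(i) p.47] -/
theorem supp_factorMap_of_subset (f : directSum M) :
    supp (factorMap (directSum M) (Perfection.of (directSum M) f)) ⊆
      (fun i => Primes.perfectionEquiv (isPerfFactorial hM).isDivisorial.isSharp (primeOf hM i)) ''
        dsupp (f : ∀ j, M j) := by
  intro 𝔮 h𝔮
  obtain ⟨𝔭, rfl⟩ := (Primes.perfectionEquiv (isPerfFactorial hM).isDivisorial.isSharp).surjective 𝔮
  exact ⟨idx hM 𝔭, (mem_supp_factorMap_of_iff hM f 𝔭).mp h𝔮, by simp only [primeOf_idx]⟩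

/-- **`Supp(ι(f))` is finite** for `f ∈ ⊕_i M_i`. [cite: MochizukiFrdI2008, Def. 2.4(i) p.47] -/
theorem supp_factorMap_of_finite (f : directSum M) :
    (supp (factorMap (directSum M) (Perfection.of (directSum M) f))).Finite :=
  ((finite_dsupp f).image _).subset (supp_factorMap_of_subset hM f)

/-- **`Supp(b)` is finite for every `b ∈ (⊕_i M_i)^pf`** (`b = f^{1/n}` has the support of `ι(f) = b^n`).
[cite: MochizukiFrdI2008, Def. 2.4(i) p.47] -/
theorem supp_factorMap_finite (b : Perfection (directSum M)) : (supp (factorMap (directSum M) b)).Finite := by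
  obtain ⟨⟨f, n⟩, rfl⟩ := Perfection.mk_surjective b
  dsimp only
  have h := supp_factorMap_of_finite hM f
  rw [← Perfection.mk_pow_self f n, ← (isPerfFactorial hM).factorHom_apply, map_pow,
    (isPerfFactorial hM).factorHom_apply, supp_pow _ n.pos] at h
  exact h

/-- **Every element of `(⊕_i M_i)^rlf` has finite support** (its support lies in `Supp(b)` for some
`b ∈ (⊕_i M_i)^pf`): realified divisors of the §6 examples are finitely supported. [cite: MochizukiFrdI2008, Def. 2.4(i) p.48] -/
theorem supp_coe_rlf_finite (a : (isPerfFactorial hM).Rlf) : (supp (a : RlfFactor (directSum M))).Finite := by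
  obtain ⟨b, hb⟩ := ((isPerfFactorial hM).mem_realification_iff (a : RlfFactor (directSum M))).mp a.2
  exact (supp_factorMap_finite hM b).subset hb

end DirectSum

end Literature.AlgebraicGeometry.Frobenioids
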